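import Mathlib.GroupTheory.Nilpotent
import Mathlib.GroupTheory.Sylow
import Mathlib.Analysis.SpecialFunctions.Pow.Real
import Mathlib.Analysis.SpecialFunctions.Log.Basic
import Literature.Barriers.MatrixMultiplication.NilpotentGroupBarrierPStraighten
import Literature.Barriers.MatrixMultiplication.NilpotentGroupBarrierPSeries
import Literature.Barriers.MatrixMultiplication.NilpotentGroupBarrierPCounting
import Literature.Barriers.MatrixMultiplication.NilpotentGroupBarrierMatchings
import HarnessLib

/-!
# Proofs of BCCGU 2017, Cor. 3.20 and Thm. B.8, and discharge of the catalogue entry `NilpotentGroupBarrier`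

Topic `Literature/Barriers/MatrixMultiplication`; final proof file attached to the catalogue
entry `NilpotentGroupBarrier.lean`: `BCCGU2017_cor320_holds : BCCGU2017_cor320` and
`NilpotentGroupBarrier_holds : NilpotentGroupBarrier`
(`= BCCGU2017_cor320 ∧ BCCGU2017_cor211 ∧ Sawin2018_thm15`, the last two discharged in
`NilpotentGroupBarrierMatchings.lean` and `NilpotentGroupBarrierSawin.lean`).

Source: J. Blasiak, T. Church, H. Cohn, J. A. Grochow, C. Umans, *Which groups are amenable to
proving exponent two for matrix multiplication?*, arXiv:1712.02302
[BlasiakChurchCohnGrochowUmans2017]: Thm. 3.8 / Thm. 3.11 (slice rank of `𝔽_p[P]` for a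
`p`-group `P`), Lemma 3.18 (bounded length), Thm. 3.19 and its proof ("at least one of its Sylow
subgroups `P` has size `|P| ≥ |G|^{Ω(1)}` … and uses Lemma 3.21 to extend from `P` to `G`"),
Cor. 3.20 ("STPP constructions in families of nilpotent groups of bounded exponent and bounded
nilpotency class cannot achieve `ω = 2`"; "the length `ℓ` is at most `mc`"), Cor. 2.11 (held
text `paper:arxiv-1712.02302`, pp. 5–9).

## The proof (effective reading of the printed one)

1. `exists_sliceRank_prod_le` (Thm. 3.11 + Lemma 3.21 for a direct factor): for a `p`-central
   generating system with `≤ L_max` levels on `S` (`NilpotentGroupBarrierPWords/PStraighten`),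
   `slice-rank_{𝔽_p} D_{S × H} ≤ 3 ρ^{|ι|} |S| |H|`, `ρ = ρ(p, L_max) < 1`: the graded coordinates
   `PCGS.gradedCoords ⊗ trivial` (`NilpotentGroupBarrierGradedCoords`), the codimension bound
   `GradedCoords.sliceRank_le` at `(t, t)` (Prop. 3.2 / Lemma 3.3) and the two tail bounds of
   `NilpotentGroupBarrierPCounting` (the degree `Σ e_a (p+1)^{lvl a}` has weights in
   `[1, (p+1)^{L_max}]`).
2. `exists_sliceRank_pgroup_prod_le`: with `exists_pcgs` (`NilpotentGroupBarrierPSeries`,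
   `L = c·e`) this gives `≤ 3 |S|^{1-δ} |H|` for finite `p`-groups `S` of class `≤ c` and
   exponent `∣ p^e`, `δ = -log ρ / log p > 0`.
3. `exists_matching_bound` (Thm. 3.19, bounded class): a finite nilpotent `G` of exponent `≤ m`
   and class `≤ c` is `∏_q P_q` over its Sylow subgroups (`Sylow.directProductOfNormal`), every
   prime `q ∣ |G|` is `≤ m` (Cauchy), so the largest Sylow subgroup `S = P_p` has
   `|G| ≤ |S|^{m+1}`; `S` has class `≤ c` and exponent `p^i ≤ m`, `i ≤ m`; by step 2 and
   Prop. 2.10 every multiplicative matching in `G ≅ S × ∏_{q ≠ p} P_q` has size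
   `≤ 3|S|^{-δ_p}|G| ≤ 3|G|^{1-κ}`, `κ = min_{p ≤ m} δ_p/(m+1)`.
4. `BCCGU2017_cor320_holds` (Cor. 3.20 via Thm. 2.8/2.9/Cor. 2.11): the family is closed under
   the products/powers of the BCCGNSU engine (`exponent_pi`, `nilpotencyClass_pi/prod`), so
   `SimultaneousTPP.sum_rpow_le_of_matching_bound` and
   `sum_rpow_le_charDegreePowSum_of_sum_rpow_le` (`NilpotentGroupBarrierMatchings`) give (2.2) at
   `w = 2 + 2κ`.

## BCCGU 2017, Thm. B.8 (App. B): cyclic groups have full slice rank — discharged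

Last section: `BCCGU2017_thmB8_holds : BCCGU2017_thmB8` (the named fact of
`NilpotentGroupBarrier.lean`: `slice-rank_K D_{ℤ/n} = n` for algebraically closed `K`, `n ≥ 1`),
through the stronger `sliceRank_addGroupTensor_zmod` (every field `K`). Printed proof (held text
`paper:arxiv-1712.02302`, App. B, pp. 13–15): Def. B.1 (flat rank), Obs. B.2 (flat rank ≤ slice
rank: annihilate one family of slices, the contractions have rank `≤ a + b`), Thm. B.4 (flat rank
is additive; Zariski density over an infinite field), Cor. B.7 (semisimple group algebras),
Lemma B.9 (`𝔽_p[ℤ/p^r] ≅ 𝔽_p[x]/(x^{p^r})`: the contractions are combinations of shifted triangular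
matrices `M_d`, of rank the largest `d` present, and a codimension-`c` subspace is not inside
`span(M_1, …, M_{p^r−c−1})` by dimension), Thm. B.8 = B.9 + B.4 + B.7 with `n = p^e m`. The Lean
proof runs the mechanism of Lemma B.9 directly in the GROUP basis of `K[ℤ/n] ≅ K[t]/(tⁿ − 1)`,
uniformly in the characteristic (so B.4 and B.7 are not needed): `rank_contract_le` is the
computation behind Obs. B.2; `le_of_hasSliceRankLE_addGroupTensor_zmod` picks `u ≠ 0` supported on
the residues `0, …, kx` and orthogonal to the `kx` `x`-slice functions, whose circulant
contraction `u(−(y+z))` has rank `≤ ky + kz` but contains an upper triangular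
`(n − d) × (n − d)` submatrix with nonzero diagonal, `d ≤ kx`.
-/

noncomputable section

open scoped BigOperators
open Finset

namespace Literature.Barriers.MatrixMultiplication

open Literature.Combinatorics.Additive Literature.RepresentationTheory.FiniteGroups

/-! ## Step 1: slice rank of `𝔽_p[S × H]` for a `p`-group `S` with a `p`-central generating system -/

/-- **Thm. 3.11 + Lemma 3.21 (direct factor), effective**: for a prime `p` and a bound `Lmax` on
the number of levels there is `ρ < 1` such that for every finite group `S` carrying a
`p`-central generating system with `≤ Lmax` levels and alphabet `ι`, and every finite group `H`,
`slice-rank_{𝔽_p} D_{S × H} ≤ 3 ρ^{|ι|} |S| |H|` (`|S| = p^{|ι|}`): graded coordinates from the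
monomial basis (`PCGS.gradedCoords`) tensored with the group basis of `H`, the codimension bound
(`GradedCoords.sliceRank_le`) at thresholds `(t, t)`, and the tail bounds `exists_tail_decay`.
[cite: BlasiakChurchCohnGrochowUmans2017, Thm. 3.11 and Lemma 3.21] -/
theorem exists_sliceRank_prod_le (p Lmax : ℕ) : ∃ ρ : ℝ, 0 < ρ ∧ ρ < 1 ∧
    ∀ [Fact p.Prime] (S : Type) [Group S] [Fintype S] [DecidableEq S]
      (ι : Type) [LinearOrder ι] [Fintype ι] (C : PCGS p S ι), C.L ≤ Lmax →
      ∀ (H : Type) [Group H] [Fintype H] [DecidableEq H],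
        (sliceRank (mulGroupTensor (ZMod p) (S × H)) : ℝ) ≤
          3 * ρ ^ Fintype.card ι * Fintype.card S * Fintype.card H := by
  classical
  by_cases hp : p.Prime
  swap
  · refine ⟨1 / 2, by norm_num, by norm_num, ?_⟩
    intro hfact
    exact absurd hfact.out hp
  have hp2 : 2 ≤ p := hp.two_le
  obtain ⟨ρ, hρ0, hρ1, hdecay⟩ := exists_tail_decay hp2 (Wmax := (p + 1) ^ Lmax)
    (Nat.one_le_pow _ _ (Nat.succ_pos p))
  refine ⟨ρ, hρ0, hρ1, ?_⟩
  intro _ S _ _ _ ι _ _ C hL H _ _ _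
  -- graded coordinates on `S × H`
  set B := (C.gradedCoords (ZMod p)).prod (GradedCoords.trivial (ZMod p) H) with hB
  -- the weights
  have hw1 : ∀ a : ι, 1 ≤ C.W a := fun a => Nat.one_le_pow _ _ (Nat.succ_pos p)
  have hwW : ∀ a : ι, C.W a ≤ (p + 1) ^ Lmax := fun a =>
    Nat.pow_le_pow_right (Nat.succ_pos p) ((C.lvl_lt a).le.trans hL)
  obtain ⟨t, hlow, hhigh⟩ := hdecay ι C.W hw1 hwW
  have hsr := B.sliceRank_le t t
  -- rewrite the three counts
  have hdeg : ∀ i : (ι → Fin p) × H, B.deg i = ∑ a, (i.1 a : ℕ) * C.W a := by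
    intro i
    rw [hB, GradedCoords.prod_deg, GradedCoords.trivial_deg, add_zero, PCGS.gradedCoords_deg]
    rfl
  have hc1 : Fintype.card {i : (ι → Fin p) × H // B.deg i < t} =
      Fintype.card {e : ι → Fin p // ∑ a, (e a : ℕ) * C.W a < t} * Fintype.card H := by
    rw [← Fintype.card_prod]
    refine Fintype.card_congr ?_
    exact
      { toFun := fun x => (⟨x.1.1, by have := x.2; rwa [hdeg] at this⟩, x.1.2)
        invFun := fun y => ⟨(y.1.1, y.2), by rw [hdeg]; exact y.1.2⟩
        left_inv := fun x => by simp
        right_inv := fun y => by simp }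
  have hc2 : Fintype.card {i : (ι → Fin p) × H // t + t ≤ B.deg i} =
      Fintype.card {e : ι → Fin p // t + t ≤ ∑ a, (e a : ℕ) * C.W a} * Fintype.card H := by
    rw [← Fintype.card_prod]
    refine Fintype.card_congr ?_
    exact
      { toFun := fun x => (⟨x.1.1, by have := x.2; rwa [hdeg] at this⟩, x.1.2)
        invFun := fun y => ⟨(y.1.1, y.2), by rw [hdeg]; exact y.1.2⟩
        left_inv := fun x => by simp
        right_inv := fun y => by simp }
  rw [hc1, hc2] at hsr
  have hsr' : (sliceRank (mulGroupTensor (ZMod p) (S × H)) : ℝ) ≤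
      (Fintype.card {e : ι → Fin p // ∑ a, (e a : ℕ) * C.W a < t} : ℝ) * Fintype.card H +
      (Fintype.card {e : ι → Fin p // ∑ a, (e a : ℕ) * C.W a < t} : ℝ) * Fintype.card H +
      (Fintype.card {e : ι → Fin p // t + t ≤ ∑ a, (e a : ℕ) * C.W a} : ℝ) * Fintype.card H := by
    exact_mod_cast hsr
  -- `|S| = p^{|ι|}`
  have hS : (Fintype.card S : ℝ) = (p : ℝ) ^ Fintype.card ι := by
    rw [← Nat.card_eq_fintype_card, C.card_eq]; push_cast; rfl
  have hH : (0 : ℝ) ≤ Fintype.card H := Nat.cast_nonneg _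
  calc (sliceRank (mulGroupTensor (ZMod p) (S × H)) : ℝ) ≤ _ := hsr'
    _ ≤ ρ ^ Fintype.card ι * (p : ℝ) ^ Fintype.card ι * Fintype.card H +
        ρ ^ Fintype.card ι * (p : ℝ) ^ Fintype.card ι * Fintype.card H +
        ρ ^ Fintype.card ι * (p : ℝ) ^ Fintype.card ι * Fintype.card H := by
        gcongr
    _ = 3 * ρ ^ Fintype.card ι * Fintype.card S * Fintype.card H := by rw [hS]; ring

/-! ## Step 2: `p`-groups of bounded class and exponent, times anything -/

/-- For a prime `p` and bounds `c`, `e` there is `δ > 0` with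
`slice-rank_{𝔽_p} D_{S × H} ≤ 3 |S|^{1-δ} |H|` for every finite `p`-group `S` of class `≤ c` and
exponent dividing `p^e` (`e ≥ 1`) and every finite group `H`.
[cite: BlasiakChurchCohnGrochowUmans2017, Thm. 3.8 and Lemma 3.21] -/
theorem exists_sliceRank_pgroup_prod_le (p c e : ℕ) : ∃ δ : ℝ, 0 < δ ∧
    ∀ [Fact p.Prime] (S : Type) [Group S] [Fintype S] [DecidableEq S] [Group.IsNilpotent S],
      0 < e → Group.nilpotencyClass S ≤ c → Monoid.exponent S ∣ p ^ e →
      ∀ (H : Type) [Group H] [Fintype H] [DecidableEq H],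
        (sliceRank (mulGroupTensor (ZMod p) (S × H)) : ℝ) ≤
          3 * (Fintype.card S : ℝ) ^ (1 - δ) * Fintype.card H := by
  classical
  by_cases hp : p.Prime
  swap
  · refine ⟨1, one_pos, ?_⟩
    intro hfact
    exact absurd hfact.out hp
  obtain ⟨ρ, hρ0, hρ1, hρ⟩ := exists_sliceRank_prod_le p (c * e)
  have hp1 : (1 : ℝ) < p := by exact_mod_cast hp.one_lt
  have hlogp : 0 < Real.log p := Real.log_pos hp1
  have hlogρ : Real.log ρ < 0 := Real.log_neg hρ0 hρ1
  set δ : ℝ := -Real.log ρ / Real.log p with hδ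
  have hδ0 : 0 < δ := by rw [hδ]; exact div_pos (by linarith) hlogp
  refine ⟨δ, hδ0, ?_⟩
  intro _ S _ _ _ _ he hc hexp H _ _ _
  obtain ⟨ι, _, _, C, hCL⟩ := exists_pcgs (p := p) (S := S) he hc hexp
  have h := hρ S ι C hCL.le H
  -- `ρ^{|ι|} p^{|ι|} = |S|^{1-δ}`
  have hS : (Fintype.card S : ℝ) = (p : ℝ) ^ Fintype.card ι := by
    rw [← Nat.card_eq_fintype_card, C.card_eq]; push_cast; rfl
  have hkey : ρ ^ Fintype.card ι * (Fintype.card S : ℝ) = (Fintype.card S : ℝ) ^ (1 - δ) := by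
    rw [hS]
    have hp0 : (0 : ℝ) < p := by linarith
    have hρp : ρ = (p : ℝ) ^ (-δ) := by
      rw [Real.rpow_def_of_pos hp0, hδ]
      have : Real.log p * -(-Real.log ρ / Real.log p) = Real.log ρ := by field_simp
      rw [this, Real.exp_log hρ0]
    rw [hρp, ← Real.rpow_natCast, ← Real.rpow_natCast, ← Real.rpow_mul hp0.le,
      ← Real.rpow_mul hp0.le, ← Real.rpow_add hp0]
    congr 1; ring
  calc (sliceRank (mulGroupTensor (ZMod p) (S × H)) : ℝ)
      ≤ 3 * ρ ^ Fintype.card ι * Fintype.card S * Fintype.card H := h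
    _ = 3 * (Fintype.card S : ℝ) ^ (1 - δ) * Fintype.card H := by rw [← hkey]; ring

/-! ## Step 3: the matching bound for nilpotent groups of bounded exponent and class -/

/-- **Slice rank of `𝔽_p[G]` bounds matchings in nilpotent groups of bounded exponent and class**
(BCCGU 2017, Thm. 3.19 made effective, bounded-class case = Cor. 3.20): there is
`κ = κ(m,c) > 0` with `|M| ≤ 3|G|^{1-κ}` for every multiplicative matching `M` in a finite
nilpotent group `G` of exponent `≤ m` and class `≤ c`. Proof as printed: `G = ∏ P_q` (Sylow),
a prime `p ≤ m` with `|P_p| ≥ |G|^{1/(m+1)}` (all prime factors of `|G|` are `≤ m`), the slice rank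
bound for `𝔽_p[P_p × ∏_{q≠p} P_q]` (Step 2) and Prop. 2.10 (`IsMulMatching.card_le_sliceRank`).
[cite: BlasiakChurchCohnGrochowUmans2017, Thm. 3.19 and Cor. 3.20] -/
theorem exists_matching_bound (m c : ℕ) : ∃ κ : ℝ, 0 < κ ∧
    ∀ (G : Type) [Group G] [Fintype G] [DecidableEq G] [Group.IsNilpotent G],
      Monoid.exponent G ≤ m → Group.nilpotencyClass G ≤ c →
      ∀ (ι : Type) [Fintype ι] (s t u : ι → G), IsMulMatching s t u →
        (Fintype.card ι : ℝ) ≤ 3 * (Fintype.card G : ℝ) ^ (1 - κ) := by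
  classical
  -- the rates, prime by prime
  choose δf hδf0 hδf using fun p => exists_sliceRank_pgroup_prod_le p c m
  set PR := (Finset.range (m + 1)).filter Nat.Prime with hPR
  set κ : ℝ := if h : PR.Nonempty then PR.inf' h δf / (m + 1) else 1 with hκ
  have hκ0 : 0 < κ := by
    rw [hκ]
    split_ifs with h
    · refine div_pos ?_ (by positivity)
      exact (Finset.lt_inf'_iff h).2 fun p _ => hδf0 p
    · exact one_pos
  have hκle : ∀ p ∈ PR, κ ≤ δf p / (m + 1) := by
    intro p hp
    have hne : PR.Nonempty := ⟨p, hp⟩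
    rw [hκ, dif_pos hne]
    exact div_le_div_of_nonneg_right (Finset.inf'_le _ hp) (by positivity)
  refine ⟨κ, hκ0, ?_⟩
  intro G _ _ _ _ hexp hcl ι _ s t u hM
  -- the trivial group
  rcases Nat.lt_or_ge 1 (Fintype.card G) with hG | hG
  swap
  · have hG1 : Fintype.card G = 1 := le_antisymm hG Fintype.card_pos
    haveI : Subsingleton G := Fintype.card_le_one_iff_subsingleton.1 hG1.le
    have h1 : (Fintype.card ι : ℝ) ≤ 1 := by exact_mod_cast hM.card_le_one
    rw [hG1, Nat.cast_one, Real.one_rpow]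
    linarith
  -- exponent facts
  have hexp_pos : 0 < Monoid.exponent G := Monoid.exponent_pos.2 Monoid.ExponentExists.of_finite
  have hm : 0 < m := lt_of_lt_of_le hexp_pos hexp
  -- Sylow decomposition
  have htfae := Group.isNilpotent_of_finite_tfae (G := G)
  have h4 : ∀ (q : ℕ), Fact q.Prime → ∀ P : Sylow q G, (P : Subgroup G).Normal :=
    (htfae.out 0 3).mp (by assumption)
  have hnormal : ∀ {q : ℕ} [Fact q.Prime] (P : Sylow q G), (P : Subgroup G).Normal :=
    fun {q} hq P => h4 q hq P
  set PF := (Nat.card G).primeFactors with hPF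
  let T : PF → Type := fun q => ∀ P : Sylow (q : ℕ) G, ((P : Subgroup G) : Type)
  let e0 : (∀ q : PF, T q) ≃* G := Sylow.directProductOfNormal hnormal
  have hPFne : PF.Nonempty := by
    rw [hPF, Nat.nonempty_primeFactors, Nat.card_eq_fintype_card]; exact hG
  obtain ⟨p₀, -, hmax⟩ := Finset.exists_max_image (Finset.univ : Finset PF)
    (fun q => Fintype.card (T q)) ⟨⟨_, hPFne.choose_spec⟩, Finset.mem_univ _⟩
  have hp₀ : (p₀ : ℕ).Prime := Nat.prime_of_mem_primeFactors p₀.2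
  haveI : Fact (p₀ : ℕ).Prime := ⟨hp₀⟩
  let S : Type := ∀ P : Sylow (p₀ : ℕ) G, ((P : Subgroup G) : Type)
  let Hr : Type := ∀ q : {q : PF // q ≠ p₀}, T q
  let e1 : (∀ q : PF, T q) ≃* S × Hr := { Equiv.piSplitAt p₀ T with map_mul' := fun _ _ => rfl }
  let eG : G ≃* S × Hr := e0.symm.trans e1
  -- every prime factor of `|G|` is `≤ m`
  have hprime_le : ∀ q : ℕ, q.Prime → q ∣ Fintype.card G → q ≤ m := by
    intro q hq hqd
    haveI : Fact q.Prime := ⟨hq⟩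
    obtain ⟨x, hx⟩ := exists_prime_orderOf_dvd_card q hqd
    have : q ∣ Monoid.exponent G := hx ▸ Monoid.order_dvd_exponent x
    exact (Nat.le_of_dvd hexp_pos this).trans hexp
  have hPFcard : PF.card ≤ m + 1 := by
    calc PF.card ≤ (Finset.range (m + 1)).card := Finset.card_le_card fun q hq => by
            rw [Finset.mem_range]
            have hq' := Nat.dvd_of_mem_primeFactors hq
            rw [Nat.card_eq_fintype_card] at hq'
            exact Nat.lt_succ_of_le (hprime_le q (Nat.prime_of_mem_primeFactors hq) hq')
      _ = m + 1 := Finset.card_range _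
  have hp₀m : (p₀ : ℕ) ∈ PR := by
    rw [hPR, Finset.mem_filter, Finset.mem_range]
    have hq' := Nat.dvd_of_mem_primeFactors p₀.2
    rw [Nat.card_eq_fintype_card] at hq'
    exact ⟨Nat.lt_succ_of_le (hprime_le _ hp₀ hq'), hp₀⟩
  -- `S` is a `p₀`-group of class `≤ c` and exponent dividing `p₀^m`
  have hScl : Group.nilpotencyClass S ≤ c := by
    show Group.nilpotencyClass (∀ P : Sylow (p₀ : ℕ) G, ((P : Subgroup G) : Type)) ≤ c
    rw [Group.nilpotencyClass_pi]
    exact Finset.sup_le fun P _ => (Subgroup.nilpotencyClass_le _).trans hcl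
  have hScard : ∃ n, Fintype.card S = (p₀ : ℕ) ^ n := by
    refine ⟨(Nat.card G).factorization p₀ * Fintype.card (Sylow (p₀ : ℕ) G), ?_⟩
    show Fintype.card (∀ P : Sylow (p₀ : ℕ) G, ((P : Subgroup G) : Type)) = _
    rw [Fintype.card_pi]
    have hP : ∀ P : Sylow (p₀ : ℕ) G,
        Fintype.card ((P : Subgroup G) : Type) = (p₀ : ℕ) ^ (Nat.card G).factorization p₀ := fun P => by
      rw [← Nat.card_eq_fintype_card]; exact Sylow.card_eq_multiplicity P
    rw [Finset.prod_congr rfl fun P _ => hP P, Finset.prod_const, Finset.card_univ, pow_mul]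
  have hSexp : Monoid.exponent S ∣ (p₀ : ℕ) ^ m := by
    obtain ⟨n, hn⟩ := hScard
    have h1 : Monoid.exponent S ∣ (p₀ : ℕ) ^ n := hn ▸ Group.exponent_dvd_card
    obtain ⟨i, -, hi⟩ := (Nat.dvd_prime_pow hp₀).1 h1
    -- `exponent S ∣ exponent G ≤ m`
    have h2 : Monoid.exponent S ∣ Monoid.exponent G := by
      refine Monoid.exponent_dvd_of_forall_pow_eq_one fun x => ?_
      have hinj : Function.Injective (eG.symm.toMonoidHom.comp (MonoidHom.inl S Hr)) :=
        eG.symm.injective.comp fun a b h => (Prod.mk.inj h).1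
      apply hinj
      rw [map_pow, Monoid.pow_exponent_eq_one, map_one]
    have h3 : (p₀ : ℕ) ^ i ≤ m := hi ▸ (Nat.le_of_dvd hexp_pos h2).trans hexp
    have h4 : i ≤ m := ((Nat.lt_pow_self hp₀.one_lt).le.trans h3)
    rw [hi]
    exact pow_dvd_pow _ h4
  -- the slice rank bound and the matching bound
  have hsr : (sliceRank (mulGroupTensor (ZMod p₀) (S × Hr)) : ℝ) ≤
      3 * (Fintype.card S : ℝ) ^ (1 - δf p₀) * Fintype.card Hr := hδf p₀ S hm hScl hSexp Hr
  have hmatch : (Fintype.card ι : ℝ) ≤ (sliceRank (mulGroupTensor (ZMod p₀) (S × Hr)) : ℝ) := by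
    rw [← sliceRank_mulGroupTensor_congr (K := ZMod p₀) eG]
    exact_mod_cast hM.card_le_sliceRank (K := ZMod p₀)
  -- sizes: `|G| = |S| |Hr|`, `|G| ≤ |S|^{m+1}`
  have hGSH : (Fintype.card G : ℝ) = Fintype.card S * Fintype.card Hr := by
    rw [Fintype.card_congr eG.toEquiv, Fintype.card_prod]; push_cast; rfl
  have hGle : Fintype.card G ≤ Fintype.card S ^ (m + 1) := by
    have h1 : Fintype.card G = ∏ q : PF, Fintype.card (T q) := by
      rw [← Fintype.card_congr e0.toEquiv, Fintype.card_pi]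
    rw [h1]
    calc ∏ q : PF, Fintype.card (T q) ≤ Fintype.card S ^ (Finset.univ : Finset PF).card :=
          Finset.prod_le_pow_card _ _ _ fun q _ => hmax q (Finset.mem_univ q)
      _ ≤ Fintype.card S ^ (m + 1) := by
          refine Nat.pow_le_pow_right Fintype.card_pos ?_
          rw [Finset.card_univ, Fintype.card_coe]
          exact hPFcard
  -- real arithmetic
  have hSpos : (0 : ℝ) < Fintype.card S := by exact_mod_cast Fintype.card_pos
  have hGpos : (0 : ℝ) < Fintype.card G := by exact_mod_cast Fintype.card_pos
  have hG1 : (1 : ℝ) ≤ Fintype.card G := by exact_mod_cast Fintype.card_pos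
  have hHrpos : (0 : ℝ) ≤ Fintype.card Hr := Nat.cast_nonneg _
  -- `|S|^{-δ} ≤ |G|^{-κ}`
  have hδκ : (Fintype.card S : ℝ) ^ (-δf p₀) ≤ (Fintype.card G : ℝ) ^ (-κ) := by
    have h1 : (Fintype.card G : ℝ) ^ ((1 : ℝ) / (m + 1)) ≤ Fintype.card S := by
      have h2 : (Fintype.card G : ℝ) ≤ (Fintype.card S : ℝ) ^ ((m + 1 : ℕ) : ℝ) := by
        rw [Real.rpow_natCast]; exact_mod_cast hGle
      calc (Fintype.card G : ℝ) ^ ((1 : ℝ) / (m + 1))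
          ≤ ((Fintype.card S : ℝ) ^ ((m + 1 : ℕ) : ℝ)) ^ ((1 : ℝ) / (m + 1)) :=
            Real.rpow_le_rpow hGpos.le h2 (by positivity)
        _ = Fintype.card S := by
            rw [← Real.rpow_mul hSpos.le]
            have : ((m + 1 : ℕ) : ℝ) * (1 / (m + 1)) = 1 := by push_cast; field_simp
            rw [this, Real.rpow_one]
    calc (Fintype.card S : ℝ) ^ (-δf p₀)
        ≤ ((Fintype.card G : ℝ) ^ ((1 : ℝ) / (m + 1))) ^ (-δf p₀) :=
          Real.rpow_le_rpow_of_nonpos (Real.rpow_pos_of_pos hGpos _) h1 (by linarith [hδf0 p₀])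
      _ = (Fintype.card G : ℝ) ^ (-(δf p₀ / (m + 1))) := by
          rw [← Real.rpow_mul hGpos.le]; congr 1; ring
      _ ≤ (Fintype.card G : ℝ) ^ (-κ) := by
          refine Real.rpow_le_rpow_of_exponent_le hG1 ?_
          linarith [hκle _ hp₀m]
  calc (Fintype.card ι : ℝ) ≤ _ := hmatch
    _ ≤ 3 * (Fintype.card S : ℝ) ^ (1 - δf p₀) * Fintype.card Hr := hsr
    _ = 3 * ((Fintype.card S : ℝ) * Fintype.card Hr) * (Fintype.card S : ℝ) ^ (-δf p₀) := by
        rw [sub_eq_add_neg, Real.rpow_add hSpos, Real.rpow_one]; ring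
    _ ≤ 3 * ((Fintype.card S : ℝ) * Fintype.card Hr) * (Fintype.card G : ℝ) ^ (-κ) := by
        gcongr
    _ = 3 * (Fintype.card G : ℝ) ^ (1 - κ) := by
        rw [← hGSH, sub_eq_add_neg, Real.rpow_add hGpos, Real.rpow_one]; ring

/-! ## Step 4: Corollary 3.20 and the catalogue entry -/

/-- Exponent of `((G^N)^3)^{N'}` is at most that of `G`. [folklore] -/
theorem exponent_pi_prod_pi_le' {G : Type*} [Group G] [Finite G] (N N' : ℕ) :
    Monoid.exponent (Fin N' → (Fin N → G) × (Fin N → G) × (Fin N → G)) ≤ Monoid.exponent G := by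
  refine Monoid.exponent_min' _ (Monoid.exponent_pos.2 Monoid.ExponentExists.of_finite) fun g => ?_
  ext l <;> simp [Monoid.pow_exponent_eq_one]

/-- Nilpotency class of `((G^N)^3)^{N'}` is at most that of `G`. [folklore] -/
theorem nilpotencyClass_pi_prod_pi_le {G : Type*} [Group G] [Group.IsNilpotent G] (N N' : ℕ) :
    Group.nilpotencyClass (Fin N' → (Fin N → G) × (Fin N → G) × (Fin N → G)) ≤
      Group.nilpotencyClass G := by
  rw [Group.nilpotencyClass_pi]
  refine Finset.sup_le fun _ _ => ?_
  rw [Group.nilpotencyClass_prod, Group.nilpotencyClass_prod, Group.nilpotencyClass_pi]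
  refine max_le (Finset.sup_le fun _ _ => le_rfl) (max_le (Finset.sup_le fun _ _ => le_rfl)
    (Finset.sup_le fun _ _ => le_rfl))

/-- **BCCGU 2017, Corollary 3.20**, discharged: `BCCGU2017_cor320` holds, with `ε = 2κ(m,c)`.
Proof as printed (Thm. 3.19 → Cor. 2.11): the matching bound `exists_matching_bound`
(slice rank of `𝔽_p[G]` via the Jennings-type basis of a large Sylow subgroup) holds uniformly in
the family of finite nilpotent groups of exponent `≤ m` and class `≤ c`, which is closed under the
powers-and-products used by the BCCGNSU engine (`SimultaneousTPP.sum_rpow_le_of_matching_bound`,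
Thm. 2.9 effective); the packing step `sum_rpow_le_charDegreePowSum_of_sum_rpow_le` (Thm. 2.8)
gives Inequality (2.2) at `w = 2 + ε`. [cite: BlasiakChurchCohnGrochowUmans2017, Cor. 3.20] -/
theorem BCCGU2017_cor320_holds : BCCGU2017_cor320 := by
  intro m c
  obtain ⟨κ, hκ, hbound⟩ := exists_matching_bound m c
  refine ⟨2 * κ, by positivity, ?_⟩
  intro G _ _ _ hexp hcl N S T U hS
  classical
  have hGpos : (0 : ℝ) < Fintype.card G := by exact_mod_cast Fintype.card_pos
  have hY : 0 < (Fintype.card G : ℝ) ^ (1 - κ) := Real.rpow_pos_of_pos hGpos _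
  -- the matching bound in the powers `((G^N₁)^3)^{N'}`
  have hMM : ∀ (N₁ N' : ℕ) (ι' : Type) [Fintype ι']
      (s t u : ι' → (Fin N' → (Fin N₁ → G) × (Fin N₁ → G) × (Fin N₁ → G))),
      IsMulMatching s t u →
        (Fintype.card ι' : ℝ) ≤ 3 * (((Fintype.card G : ℝ) ^ (1 - κ)) ^ (3 * N₁)) ^ N' := by
    intro N₁ N' ι' _ s t u h
    have h1 := hbound (Fin N' → (Fin N₁ → G) × (Fin N₁ → G) × (Fin N₁ → G))
      ((exponent_pi_prod_pi_le' N₁ N').trans hexp) ((nilpotencyClass_pi_prod_pi_le N₁ N').trans hcl)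
      ι' s t u h
    have hcard : (Fintype.card (Fin N' → (Fin N₁ → G) × (Fin N₁ → G) × (Fin N₁ → G)) : ℝ) =
        (Fintype.card G : ℝ) ^ (3 * N₁ * N') := by
      rw [Fintype.card_fun, Fintype.card_prod, Fintype.card_prod, Fintype.card_fun, Fintype.card_fin,
        Fintype.card_fin]
      push_cast
      ring
    rw [hcard] at h1
    refine h1.trans (le_of_eq ?_)
    rw [← pow_mul, ← Real.rpow_mul_natCast hGpos.le, ← Real.rpow_natCast_mul hGpos.le]
    congr 2
    push_cast
    ring
  have hsum := SimultaneousTPP.sum_rpow_le_of_matching_bound hY hMM hS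
  have h := sum_rpow_le_charDegreePowSum_of_sum_rpow_le hκ hS hsum
  convert h using 2

/-- **The catalogue entry `NilpotentGroupBarrier`, discharged**: Cor. 3.20 ∧ Cor. 2.11 ∧ Sawin's
Thm. 1.5 all hold (`BCCGU2017_cor320_holds`, `BCCGU2017_cor211_holds`, `Sawin2018_thm15_holds`).
[cite: BlasiakChurchCohnGrochowUmans2017, Thm. 3.19 and Cor. 3.20] [cite: Sawin2018, Thm. 1.5] -/
theorem NilpotentGroupBarrier_holds : NilpotentGroupBarrier :=
  ⟨BCCGU2017_cor320_holds, BCCGU2017_cor211_holds, Sawin2018_thm15_holds⟩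

/-! ## BCCGU 2017, Thm. B.8: cyclic groups have full slice rank over every field -/

section CyclicFullSliceRank

open Matrix

variable {K : Type*} [Field K]

/-- Subadditivity of `Matrix.rank` (over a field). [folklore] -/
private theorem rank_add_le_aux {m n : Type*} [Fintype n] (A B : Matrix m n K) :
    (A + B).rank ≤ A.rank + B.rank := by
  unfold Matrix.rank
  rw [Matrix.mulVecLin_add]
  calc Module.finrank K (LinearMap.range (A.mulVecLin + B.mulVecLin))
      ≤ Module.finrank K ↥(LinearMap.range A.mulVecLin ⊔ LinearMap.range B.mulVecLin) := by
        apply Submodule.finrank_mono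
        rintro _ ⟨v, rfl⟩
        exact Submodule.add_mem_sup ⟨v, rfl⟩ ⟨v, rfl⟩
    _ ≤ _ := Submodule.finrank_add_le_finrank_add_finrank _ _

/-- `rank (Σᵢ Aᵢ) ≤ Σᵢ rank Aᵢ`. [folklore] -/
private theorem rank_sum_le_aux {m n : Type*} [Fintype n] {η : Type*} (s : Finset η)
    (A : η → Matrix m n K) : (∑ i ∈ s, A i).rank ≤ ∑ i ∈ s, (A i).rank := by
  classical
  induction s using Finset.induction_on with
  | empty => simp
  | insert a s ha ih =>
    rw [Finset.sum_insert ha, Finset.sum_insert ha]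
    exact (rank_add_le_aux _ _).trans (by omega)

/-- **BCCGU 2017, Observation B.2 (flat rank ≤ slice rank), the computation**: contracting a slice
decomposition `D = Σ_{r<kx} f₁ʳ(x)g₁ʳ(y,z) + Σ_{r<ky} f₂ʳ(y)g₂ʳ(x,z) + Σ_{r<kz} f₃ʳ(z)g₃ʳ(x,y)`
against a vector `u` annihilating the `x`-slice functions `f₁ʳ` kills the first group and leaves
the `Y × Z` matrix `(y,z) ↦ Σ_x u(x) D(x,y,z)` as a sum of `ky + kz` rank-one matrices ("On this
subspace, the resulting restricted matrix can be written as a sum of at most `a+b` rank 1 matrices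
… and hence has rank at most `a+b`"; the same computation is the heart of Tao's Lemma 4.7 of
BCCGNSU, `HasSliceRankLE.card_le_of_diagonal`).
[cite: BlasiakChurchCohnGrochowUmans2017, App. B (Obs. B.2 and the paragraph before Def. B.1)] -/
theorem rank_contract_le {X Y Z : Type*} [Fintype X] [Fintype Z]
    {D : X → Y → Z → K} {kx ky kz : ℕ}
    (f₁ : Fin kx → X → K) (g₁ : Fin kx → Y → Z → K) (f₂ : Fin ky → Y → K)
    (g₂ : Fin ky → X → Z → K) (f₃ : Fin kz → Z → K) (g₃ : Fin kz → X → Y → K)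
    (hdec : ∀ x y z, D x y z =
        (∑ r, f₁ r x * g₁ r y z) + (∑ r, f₂ r y * g₂ r x z) + (∑ r, f₃ r z * g₃ r x y))
    (u : X → K) (huF : ∀ r, ∑ x, f₁ r x * u x = 0) :
    (Matrix.of fun y z => ∑ x, u x * D x y z).rank ≤ ky + kz := by
  have hMdec : (Matrix.of fun y z => ∑ x, u x * D x y z) =
      (∑ r, Matrix.vecMulVec (f₂ r) fun z => ∑ x, u x * g₂ r x z) +
      ∑ r, Matrix.vecMulVec (fun y => ∑ x, u x * g₃ r x y) (f₃ r) := by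
    ext y z
    simp only [Matrix.of_apply, Matrix.add_apply, Matrix.sum_apply, Matrix.vecMulVec_apply]
    have step : ∀ x, u x * D x y z = (∑ r, (f₁ r x * u x) * g₁ r y z) +
        ((∑ r, f₂ r y * (u x * g₂ r x z)) + ∑ r, (u x * g₃ r x y) * f₃ r z) := by
      intro x
      rw [hdec x y z, mul_add, mul_add, Finset.mul_sum, Finset.mul_sum, Finset.mul_sum, add_assoc]
      congr 1
      · exact Finset.sum_congr rfl fun r _ => by ring
      · congr 1
        · exact Finset.sum_congr rfl fun r _ => by ring
        · exact Finset.sum_congr rfl fun r _ => by ring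
    simp_rw [step]
    rw [Finset.sum_add_distrib, Finset.sum_add_distrib]
    have hzero : ∑ x, ∑ r, f₁ r x * u x * g₁ r y z = 0 := by
      rw [Finset.sum_comm]
      refine Finset.sum_eq_zero fun r _ => ?_
      rw [← Finset.sum_mul, huF r, zero_mul]
    rw [hzero, zero_add]
    congr 1
    · rw [Finset.sum_comm]
      exact Finset.sum_congr rfl fun r _ => by rw [Finset.mul_sum]
    · rw [Finset.sum_comm]
      exact Finset.sum_congr rfl fun r _ => by rw [Finset.sum_mul]
  rw [hMdec]
  refine (rank_add_le_aux _ _).trans (add_le_add ?_ ?_)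
  · refine (rank_sum_le_aux _ _).trans ?_
    calc ∑ r : Fin ky, (Matrix.vecMulVec (f₂ r) fun z => ∑ x, u x * g₂ r x z).rank
        ≤ ∑ _r : Fin ky, 1 := Finset.sum_le_sum fun r _ => Matrix.rank_vecMulVec_le _ _
      _ = ky := by simp
  · refine (rank_sum_le_aux _ _).trans ?_
    calc ∑ r : Fin kz, (Matrix.vecMulVec (fun y => ∑ x, u x * g₃ r x y) (f₃ r)).rank
        ≤ ∑ _r : Fin kz, 1 := Finset.sum_le_sum fun r _ => Matrix.rank_vecMulVec_le _ _
      _ = kz := by simp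

/-- **Cyclic groups have full slice rank over every field** (the content of BCCGU 2017, Thm. B.8,
`HasSliceRankLE` form): every slice decomposition of `D_{ℤ/n}(x,y,z) = [x + y + z = 0]` over any
field `K` uses at least `n` slices. Proof (the mechanism of BCCGU Lemma B.9 — truncated/circulant
multiplication matrices are triangular, plus a dimension count — run directly in the group basis of
`K[ℤ/n] ≅ K[t]/(tⁿ − 1)`, so that neither the additivity of flat rank, Thm. B.4, nor the
semisimple case, Cor. B.7, is needed): given a decomposition with `kx + ky + kz < n`, choose
`u ≠ 0` supported on the residues `0, …, kx` and orthogonal to the `kx` `x`-slice functions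
(`kx + 1` unknowns, `kx` equations); the contraction `M(y,z) = Σ_x u(x) D(x,y,z) = u(−(y+z))` has
rank `≤ ky + kz` (`rank_contract_le`), while for `d = max {val x : u x ≠ 0} ≤ kx` its
`(n−d) × (n−d)` submatrix on rows `−(d+i)` and columns `j` has entries `u(d+i−j)`: upper
triangular with diagonal `u(d) ≠ 0`, hence of rank `n − d ≥ n − kx` — a contradiction.
[cite: BlasiakChurchCohnGrochowUmans2017, Thm. B.8 and Lemma B.9 (proof)] -/
theorem le_of_hasSliceRankLE_addGroupTensor_zmod {n : ℕ} [NeZero n] {k : ℕ}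
    (h : HasSliceRankLE (addGroupTensor K (ZMod n)) k) : n ≤ k := by
  classical
  obtain ⟨kx, ky, kz, hk, f₁, g₁, f₂, g₂, f₃, g₃, hdec⟩ := h
  refine not_lt.1 fun hlt => ?_
  have hkx : kx + 1 ≤ n := by omega
  -- the residues `0, …, kx` are distinct in `ZMod n`
  have hval : ∀ j : Fin (kx + 1), (((j : ℕ) : ZMod n)).val = j := fun j =>
    ZMod.val_cast_of_lt (lt_of_lt_of_le j.isLt hkx)
  have hinj : ∀ j j' : Fin (kx + 1), ((j : ℕ) : ZMod n) = ((j' : ℕ) : ZMod n) → j = j' := by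
    intro j j' hjj'
    have h1 := congrArg ZMod.val hjj'
    rw [hval, hval] at h1
    exact Fin.ext h1
  -- Step 1: `kx` linear conditions on `kx + 1` unknowns have a nonzero solution `c`
  obtain ⟨F, hF⟩ : ∃ F : Matrix (Fin kx) (Fin (kx + 1)) K,
      F = Matrix.of fun r (j : Fin (kx + 1)) => f₁ r ((j : ℕ) : ZMod n) := ⟨_, rfl⟩
  have hker : LinearMap.ker F.mulVecLin ≠ ⊥ := by
    apply LinearMap.ker_ne_bot_of_finrank_lt
    simp only [Module.finrank_fintype_fun_eq_card, Fintype.card_fin]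
    omega
  obtain ⟨c, hc, hc0⟩ := Submodule.exists_mem_ne_zero_of_ne_bot hker
  have hcF : ∀ r, ∑ j : Fin (kx + 1), f₁ r ((j : ℕ) : ZMod n) * c j = 0 := by
    intro r
    have h1 := congr_fun (LinearMap.mem_ker.1 hc) r
    simpa [hF, Matrix.mulVec, dotProduct] using h1
  obtain ⟨j₀, hj₀⟩ := Function.ne_iff.1 hc0
  -- the vector `u` on `ZMod n`: `c` placed on the residues `0, …, kx`, zero elsewhere
  obtain ⟨u, hu⟩ : ∃ u : ZMod n → K,
      u = fun x => ∑ j : Fin (kx + 1), if x = ((j : ℕ) : ZMod n) then c j else 0 := ⟨_, rfl⟩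
  have hu_apply : ∀ j : Fin (kx + 1), u ((j : ℕ) : ZMod n) = c j := by
    intro j
    simp only [hu]
    rw [Finset.sum_eq_single j]
    · rw [if_pos rfl]
    · intro j' _ hj'
      rw [if_neg]
      exact fun h1 => hj' (hinj _ _ h1).symm
    · exact fun h1 => absurd (mem_univ j) h1
  have hu_supp : ∀ x, u x ≠ 0 → x.val ≤ kx := by
    intro x hx
    simp only [hu] at hx
    obtain ⟨j, _, hj⟩ := Finset.exists_ne_zero_of_sum_ne_zero hx
    have hxj : x = ((j : ℕ) : ZMod n) := by
      by_contra hne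
      exact hj (if_neg hne)
    rw [hxj, hval]
    omega
  have huF : ∀ r, ∑ x, f₁ r x * u x = 0 := by
    intro r
    have h1 : ∀ x, f₁ r x * u x =
        ∑ j : Fin (kx + 1), if x = ((j : ℕ) : ZMod n) then f₁ r x * c j else 0 := by
      intro x
      simp only [hu]
      rw [Finset.mul_sum]
      exact Finset.sum_congr rfl fun j _ => by split_ifs <;> simp
    simp_rw [h1]
    rw [Finset.sum_comm]
    calc ∑ j : Fin (kx + 1), ∑ x : ZMod n, (if x = ((j : ℕ) : ZMod n) then f₁ r x * c j else 0)
        = ∑ j : Fin (kx + 1), f₁ r ((j : ℕ) : ZMod n) * c j := by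
          refine Finset.sum_congr rfl fun j _ => ?_
          simp only [Finset.sum_ite_eq', Finset.mem_univ, if_true]
      _ = 0 := hcF r
  have hu0 : u ((j₀ : ℕ) : ZMod n) ≠ 0 := by
    rw [hu_apply]
    exact hj₀
  -- `x₀`: the element of largest value in the support of `u`; `x₀.val ≤ kx`
  obtain ⟨x₀, hx₀, hmax⟩ := (univ.filter fun x : ZMod n => u x ≠ 0).exists_max_image ZMod.val
    ⟨((j₀ : ℕ) : ZMod n), mem_filter.2 ⟨mem_univ _, hu0⟩⟩
  have hx₀' : u x₀ ≠ 0 := (mem_filter.1 hx₀).2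
  have hmax' : ∀ x, u x ≠ 0 → x.val ≤ x₀.val := fun x hx =>
    hmax x (mem_filter.2 ⟨mem_univ _, hx⟩)
  have hdk : x₀.val ≤ kx := hu_supp x₀ hx₀'
  have hdn : x₀.val < n := x₀.val_lt
  -- Step 2: the contraction against `u` has rank `≤ ky + kz` …
  obtain ⟨M, hM⟩ : ∃ M : Matrix (ZMod n) (ZMod n) K,
      M = Matrix.of fun y z => ∑ x, u x * addGroupTensor K (ZMod n) x y z := ⟨_, rfl⟩
  have hrank_le : M.rank ≤ ky + kz := by
    rw [hM]
    exact rank_contract_le f₁ g₁ f₂ g₂ f₃ g₃ hdec u huF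
  -- … and is the circulant `u(−(y+z))`
  have hM_apply : ∀ y z, M y z = u (-(y + z)) := by
    intro y z
    rw [hM, Matrix.of_apply, Finset.sum_eq_single (-(y + z))]
    · rw [addGroupTensor_apply, if_pos (by abel), mul_one]
    · intro x _ hx
      rw [addGroupTensor_apply, if_neg, mul_zero]
      intro h0
      rw [add_assoc] at h0
      exact hx (eq_neg_of_add_eq_zero_left h0)
    · exact fun h1 => absurd (mem_univ _) h1
  -- Step 3: an upper triangular `(n - d) × (n - d)` submatrix with diagonal `u x₀ ≠ 0`
  obtain ⟨T, hT⟩ : ∃ T : Matrix (Fin (n - x₀.val)) (Fin (n - x₀.val)) K,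
      T = M.submatrix (fun i : Fin (n - x₀.val) => -(((x₀.val + (i : ℕ) : ℕ)) : ZMod n))
        (fun j : Fin (n - x₀.val) => ((j : ℕ) : ZMod n)) := ⟨_, rfl⟩
  have hT_apply : ∀ i j : Fin (n - x₀.val),
      T i j = u ((((x₀.val + (i : ℕ) : ℕ)) : ZMod n) - ((j : ℕ) : ZMod n)) := by
    intro i j
    rw [hT, Matrix.submatrix_apply, hM_apply]
    congr 1
    abel
  have hT_tri : T.BlockTriangular id := by
    intro i j hij
    have hij' : (j : ℕ) < (i : ℕ) := hij
    have hji : (j : ℕ) ≤ x₀.val + (i : ℕ) := by omega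
    rw [hT_apply, ← Nat.cast_sub hji]
    by_contra hne
    have h1 := hmax' _ hne
    rw [ZMod.val_cast_of_lt (by omega)] at h1
    omega
  have hT_diag : ∀ i, T i i = u x₀ := by
    intro i
    rw [hT_apply, Nat.cast_add, add_sub_cancel_right, ZMod.natCast_zmod_val]
  have hT_det : T.det ≠ 0 := by
    rw [Matrix.det_of_upperTriangular hT_tri]
    simp only [hT_diag, Finset.prod_const, Finset.card_univ, Fintype.card_fin]
    exact pow_ne_zero _ hx₀'
  have hT_rank : T.rank = n - x₀.val := by
    rw [Matrix.rank_of_isUnit T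
      ((Matrix.isUnit_iff_isUnit_det T).2 (isUnit_iff_ne_zero.2 hT_det)), Fintype.card_fin]
  have hTM : T.rank ≤ M.rank := by
    rw [hT]
    exact Matrix.rank_submatrix_le _ _ _
  omega

/-- **BCCGU 2017, Thm. B.8 over every field**: `slice-rank_K D_{ℤ/n} = n` for all `n ≥ 1` and
every field `K` (`≤`: slice along each `x`, `sliceRank_le_card`; `≥`:
`le_of_hasSliceRankLE_addGroupTensor_zmod`). [cite: BlasiakChurchCohnGrochowUmans2017, Thm. B.8] -/
theorem sliceRank_addGroupTensor_zmod (K : Type*) [Field K] (n : ℕ) [NeZero n] :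
    sliceRank (addGroupTensor K (ZMod n)) = n := by
  apply le_antisymm
  · simpa using sliceRank_le_card (addGroupTensor K (ZMod n))
  · exact le_of_hasSliceRankLE_addGroupTensor_zmod (hasSliceRankLE_sliceRank _)

/-- **Discharge of the named fact `BCCGU2017_thmB8`** (BCCGU 2017, Thm. B.8: "For any cyclic group
`G = ℤ/nℤ`, `flat-rank(M_G) = slice-rank(M_G) = |G|` in any characteristic", slice-rank part as
vendored: algebraically closed `K`, `n ≥ 1`), by `sliceRank_addGroupTensor_zmod` (which holds over
every field). [cite: BlasiakChurchCohnGrochowUmans2017, Thm. B.8] -/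
theorem BCCGU2017_thmB8_holds : BCCGU2017_thmB8 := by
  intro K _ _ n _
  exact sliceRank_addGroupTensor_zmod K n

end CyclicFullSliceRank

/-! ## Conjunct (b) in the form the catalogue uses it: powers of a fixed group, effective (audit 2026-08-17)

The catalogue entry `NilpotentGroupBarrier` vendors Sawin 2018, Thm. 1.5 as a bound on
multiplicative matchings in `Gⁿ` (`Sawin2018_thm15`, proved in `NilpotentGroupBarrierSawin.lean`)
and leaves the step "hence no `ω = 2` via (2.2) from STPP constructions in `{Gⁿ}`" to the printed
BCCGU 2017, Thm. 2.8/2.9 (scope caveat (d) of the block). The two theorems below close that step in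
the tree with the BCCGNSU engine of `NilpotentGroupBarrierMatchings.lean`, in the same effective
reading as `BCCGU2017_cor320` / `BCCGU2017_cor211`: for a FIXED non-trivial `G` one `ε = ε(|G|) > 0`
serves every power `Gⁿ`. Quantitatively `ε = 2 log(1/δ)/log|G|` for the `δ = δ(|G|)` of
`exists_sliceRank_mulGroupTensor_pi_le`, whose `log(1/δ)` is of order `1/(40|G|)`; so `ε(G) → 0`
as `|G| → ∞` — the barrier is about one fixed group and carries no uniformity in `|G|` ("this bound
is never of the form `|G|^{1-c}` … unless `|G| = O(1)` and the family is `{Gⁿ}`", BCCGU 2017, §1.1).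
-/

section SawinSTPP

/-- **Sawin 2018, Thm. 1.5 in exponent form**: for a non-trivial finite group `G` there is
`c = c(G) > 0` with `|M| ≤ |Gⁿ|^{1-c}` for every multiplicative matching `M` in every power `Gⁿ` —
the shape "`|G|^{1-c}`" which BCCGU 2017, §1.1 single out as "what is needed to rule out proving
`ω = 2` in a family of groups", available here exactly because the family is `{Gⁿ}` with `G` fixed
(`c = log(1/δ)/log|G|` for the `δ < 1` of `Sawin2018_thm15`; `δ > 0` is forced by the one-element
matching in `G¹`). [cite: Sawin2018, Thm. 1.5] [cite: BlasiakChurchCohnGrochowUmans2017, §1.1] -/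
theorem Sawin2018_thm15_rpow (G : Type) [Group G] [Fintype G] (hG : Nontrivial G) :
    ∃ c : ℝ, 0 < c ∧ ∀ (n : ℕ) (ι : Type) [Fintype ι] (s t u : ι → (Fin n → G)),
      IsMulMatching s t u → (Fintype.card ι : ℝ) ≤ ((Fintype.card G : ℝ) ^ n) ^ (1 - c) := by
  obtain ⟨δ, hδ1, hδ⟩ := Sawin2018_thm15_holds G hG
  have hG1 : (1 : ℝ) < Fintype.card G := by exact_mod_cast Fintype.one_lt_card
  have hGpos : (0 : ℝ) < Fintype.card G := by linarith
  -- `δ > 0`: the one-element matching `s = t = u = 1` in `G¹` has size `1 ≤ δ |G|`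
  have hδ0 : 0 < δ := by
    have h1 := hδ 1 Unit (fun _ => (1 : Fin 1 → G)) (fun _ => 1) (fun _ => 1) (fun i j k => by simp)
    simp only [Fintype.card_unit, Nat.cast_one, pow_one] at h1
    by_contra h
    push Not at h
    have : δ * (Fintype.card G : ℝ) ≤ 0 := mul_nonpos_of_nonpos_of_nonneg h hGpos.le
    linarith
  have hlogG : 0 < Real.log (Fintype.card G) := Real.log_pos hG1
  have hlogδ : Real.log δ < 0 := Real.log_neg hδ0 hδ1
  refine ⟨-Real.log δ / Real.log (Fintype.card G), div_pos (by linarith) hlogG, ?_⟩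
  intro n ι _ s t u hM
  have hpow : (Fintype.card G : ℝ) ^ (-Real.log δ / Real.log (Fintype.card G)) = δ⁻¹ := by
    rw [Real.rpow_def_of_pos hGpos, mul_comm, div_mul_cancel₀ _ hlogG.ne', Real.exp_neg,
      Real.exp_log hδ0]
  have hkey : (Fintype.card G : ℝ) ^ (1 - -Real.log δ / Real.log (Fintype.card G)) =
      δ * Fintype.card G := by
    rw [Real.rpow_sub hGpos, Real.rpow_one, hpow, div_inv_eq_mul, mul_comm]
  calc (Fintype.card ι : ℝ) ≤ δ ^ n * (Fintype.card G : ℝ) ^ n := hδ n ι s t u hM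
    _ = ((Fintype.card G : ℝ) ^ n) ^ (1 - -Real.log δ / Real.log (Fintype.card G)) := by
        rw [← Real.rpow_natCast_mul hGpos.le, mul_comm (n : ℝ), Real.rpow_mul_natCast hGpos.le,
          hkey, mul_pow]

/-- **No `ω = 2` via (2.2) from STPP constructions in the powers of a fixed group — effective form,
PROVED** (Sawin 2018, Thm. 1.5 / Lemma 1.3 with BCCGU 2017, Thm. 2.8–2.9; the reading of the
catalogue's `BCCGU2017_cor211`): for every non-trivial finite group `G` there is `ε = ε(|G|) > 0`
such that for EVERY `n` and every STPP construction `(Aᵢ, Bᵢ, Cᵢ)_{i<N}` in `Gⁿ` (CKSU Def. 5.1,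
the tree's `SimultaneousTPP`) the CKSU inequality (2.2) already holds at `w = 2 + ε`:
`Σᵢ (|Aᵢ||Bᵢ||Cᵢ|)^{(2+ε)/3} ≤ Σⱼ dⱼ(Gⁿ)^{2+ε}`. Proof: `p ∣ |G|`; the uniform Lemma 1.3
(`exists_sliceRank_mulGroupTensor_pi_le`: `slice-rank_{𝔽_p} D_{G^T} ≤ 3 δ^{|T|}|G|^{|T|}` for all
finite `T`) bounds, through Prop. 2.10 and the embedding `((Gⁿ)^{N₁})³)^{N'} ↪ G^{T × Fin n}`, every
matching the BCCGNSU engine asks about by `3 (Y^{3N₁})^{N'}` with `Y = (δ|G|)ⁿ = |Gⁿ|^{1-δ'}`,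
`δ' = log(1/δ)/log|G|`; then `SimultaneousTPP.sum_rpow_le_of_matching_bound` (Thm. 2.9) and
`sum_rpow_le_charDegreePowSum_of_sum_rpow_le` (Thm. 2.8) give (2.2) at `2 + 2δ'`.
[cite: Sawin2018, Thm. 1.5 and Lemma 1.3] [cite: BlasiakChurchCohnGrochowUmans2017, Thm. 2.8, Thm. 2.9 and §1.1] -/
theorem Sawin2018_thm15_stpp (G : Type) [Group G] [Fintype G] [DecidableEq G] [Nontrivial G] :
    ∃ ε : ℝ, 0 < ε ∧ ∀ (n N : ℕ) (A B C : Fin N → Finset (Fin n → G)), SimultaneousTPP A B C →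
      ∑ i, (((A i).card * (B i).card * (C i).card : ℕ) : ℝ) ^ ((2 + ε) / 3) ≤
        charDegreePowSum (Fin n → G) (2 + ε) := by
  classical
  have hcard : Fintype.card G ≠ 1 := Fintype.one_lt_card.ne'
  obtain ⟨p, hp, hpG⟩ := Nat.exists_prime_and_dvd hcard
  haveI : Fact p.Prime := ⟨hp⟩
  have hG : (Fintype.card G : ZMod p) = 0 := (ZMod.natCast_eq_zero_iff _ _).2 hpG
  obtain ⟨δ, hδ0, hδ1, hδ⟩ := exists_sliceRank_mulGroupTensor_pi_le (K := ZMod p) hG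
  have hG1 : (1 : ℝ) < Fintype.card G := by exact_mod_cast Fintype.one_lt_card
  have hGpos : (0 : ℝ) < Fintype.card G := by linarith
  have hlogG : 0 < Real.log (Fintype.card G) := Real.log_pos hG1
  have hlogδ : Real.log δ < 0 := Real.log_neg hδ0 hδ1
  -- the per-coordinate deficiency exponent `δ' = log(1/δ)/log|G|`, so that `|G|^{1-δ'} = δ|G|`
  set δ' : ℝ := -Real.log δ / Real.log (Fintype.card G) with hδ'
  have hδ'0 : 0 < δ' := div_pos (by linarith) hlogG
  have hpow : (Fintype.card G : ℝ) ^ δ' = δ⁻¹ := by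
    rw [Real.rpow_def_of_pos hGpos, hδ', mul_comm, div_mul_cancel₀ _ hlogG.ne', Real.exp_neg,
      Real.exp_log hδ0]
  have hkey : (Fintype.card G : ℝ) ^ (1 - δ') = δ * Fintype.card G := by
    rw [Real.rpow_sub hGpos, Real.rpow_one, hpow, div_inv_eq_mul, mul_comm]
  refine ⟨2 * δ', by positivity, fun n N A B C hS => ?_⟩
  -- the host `H = Gⁿ`
  have hH : (Fintype.card (Fin n → G) : ℝ) = (Fintype.card G : ℝ) ^ n := by
    rw [Fintype.card_fun, Fintype.card_fin, Nat.cast_pow]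
  have hHpos : (0 : ℝ) < Fintype.card (Fin n → G) := by rw [hH]; positivity
  have hYeq : (Fintype.card (Fin n → G) : ℝ) ^ (1 - δ') = (δ * Fintype.card G) ^ n := by
    rw [hH, ← Real.rpow_natCast_mul hGpos.le, mul_comm (n : ℝ), Real.rpow_mul_natCast hGpos.le,
      hkey]
  have hY : 0 < (Fintype.card (Fin n → G) : ℝ) ^ (1 - δ') := Real.rpow_pos_of_pos hHpos _
  have hsum := SimultaneousTPP.sum_rpow_le_of_matching_bound hY ?_ hS
  · exact sum_rpow_le_charDegreePowSum_of_sum_rpow_le hδ'0 hS hsum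
  -- the matching bound in `((H^{N₁})³)^{N'}`: embed into `G^{T × Fin n}`, use the uniform Lemma 1.3
  intro N₁ N' ι' _ s t u hM
  set T : Type := Fin N' × ((Fin N₁ ⊕ Fin N₁) ⊕ Fin N₁) with hT
  let unc : (T → (Fin n → G)) →* (T × Fin n → G) :=
    MonoidHom.mk' (fun f q => f q.1 q.2) (fun _ _ => rfl)
  have hunc : Function.Injective unc := by
    intro f g h
    funext a b
    exact congr_fun h (a, b)
  have hφ : Function.Injective (unc.comp (piProdThreeHom (G := Fin n → G) N₁ N')) :=
    hunc.comp (piProdThreeHom_injective N₁ N')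
  have h1 := (hM.map _ hφ).card_le_sliceRank (K := ZMod p)
  have h1' : (Fintype.card ι' : ℝ) ≤ sliceRank (mulGroupTensor (ZMod p) (T × Fin n → G)) := by
    exact_mod_cast h1
  have hcardT : Fintype.card (T × Fin n) = N' * (3 * N₁) * n := by
    simp only [hT, Fintype.card_prod, Fintype.card_sum, Fintype.card_fin]; ring
  calc (Fintype.card ι' : ℝ) ≤ _ := h1'
    _ ≤ 3 * δ ^ Fintype.card (T × Fin n) * (Fintype.card G : ℝ) ^ Fintype.card (T × Fin n) :=
        hδ (T × Fin n)
    _ = 3 * (((Fintype.card (Fin n → G) : ℝ) ^ (1 - δ')) ^ (3 * N₁)) ^ N' := by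
        rw [hYeq, hcardT]; ring

end SawinSTPP

end Literature.Barriers.MatrixMultiplication

end
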